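import Summits.BirchSwinnertonDyer.BirchSwinnertonDyer.Theorems.ResidualThetaTransportAtTwoThetaLayerLambdaCongruenceAtTwoWSideLayerZero
import Summits.BirchSwinnertonDyer.BirchSwinnertonDyer.Theorems.ResidualThetaTransportAtTwoThetaLayerLambdaCongruenceAtTwoEventualCrux
import HarnessLib

/-!
# Crux `ThetaLayerLambdaCongruenceAtTwo` (stmt-BirchSwinnertonDyer-20688): Kan⁺ from `λ`-equality at infinitely many even layers,
# with the `W`-side non-vanishing DISCHARGED on the habitat⁺

Width seat bsd-wall-rtt-p3-w3 (`--supports stmt-BirchSwinnertonDyer-20688`; closes nothing). THEOREMS ONLY.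

`wSide_even_layer_ne_zero`: on the habitat⁺ every EVEN-layer `W`-side depleted element is non-zero (layer `0` is non-zero,
`wSide_layer_zero_ne_zero`, and the sup norms are non-decreasing along the even layers, `wSide_supNorm_le_add_two`).
`thetaLayerLambdaCongruenceAtTwo_of_frequently_eq_habitat`: the crux BY NAME from (IO′) «for all data and every `N₀` there is an
even `n ≥ N₀` with `Θ^{S₀}_n(g;Ω) ≠ 0` and `λ(Θ^{S₀}_n(W)) = λ(Θ^{S₀}_n(g;Ω))`» — (IO) of `…EventualCrux` minus the `W`-side
non-vanishing clause. Nothing about any curve or form is asserted; BSD is not proved by any of this.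
-/

noncomputable section

-- justification: the `Summit.BirchSwinnertonDyer.BirchSwinnertonDyer.…` path repeats a component (route-file convention)
set_option linter.dupNamespace false

open scoped Classical

open Polynomial

open Literature.NumberTheory.IwasawaTheory Literature.NumberTheory.EllipticCurves
  Literature.NumberTheory.EllipticCurves.ModularForms

namespace Summit.BirchSwinnertonDyer.BirchSwinnertonDyer.Theorems.ThetaLayerLambdaCongruenceAtTwo

section WSide

variable {W : WeierstrassCurve ℚ} [W.IsElliptic] [W.IsGloballyMinimal] [NeZero (W.conductorNorm ℤ)]
  {f : CuspForm (CongruenceSubgroup.Gamma0 (W.conductorNorm ℤ)) 2}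
  (S₀ : Finset (IsDedekindDomain.HeightOneSpectrum (NumberField.RingOfIntegers ℚ)))

/-- **Every even-layer `W`-side depleted element is non-zero on the habitat⁺**: `‖Θ^{S₀}_n(W)‖_sup ≥ ‖Θ^{S₀}_0(W)‖_sup > 0` for
even `n` (monotonicity along the even layers + layer `0` non-zero). [cite: PollackWeston2011MT, §4 (shape)] -/
theorem wSide_even_layer_ne_zero (hss : Literature.NumberTheory.EllipticCurves.Rank1Residual.GoodSS W 2)
    (ha : W.frobeniusTrace 2 = 0) (hr : W.analyticRank = 0) (hf : IsNewformOf W f)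
    (hS2 : ∀ v ∈ S₀, ((2 : ℕ) : NumberField.RingOfIntegers ℚ) ∉ v.asIdeal) {n : ℕ} (hn : Even n) :
    (((Literature.NumberTheory.EllipticCurves.mazurTateElement f 2 n).map (algebraMap ℚ (PadicAlgCl 2)) * ∏ v ∈ S₀, ((W.localPolynomialAt v).map (Int.castRingHom (PadicAlgCl 2))).comp (Polynomial.C ((Rat.HeightOneSpectrum.natGenerator v : PadicAlgCl 2)⁻¹) * (Polynomial.X + 1) ^ (PadicInt.toZModPow n (-(Literature.NumberTheory.EllipticCurves.GreenbergVatsal2000.frobeniusExponent 2 (Rat.HeightOneSpectrum.natGenerator v : ℤ_[2])))).val)) %ₘ ((Polynomial.X + 1) ^ 2 ^ n - 1)) ≠ 0 := by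
  set u : ℕ → ℝ := fun m ↦ ((((Literature.NumberTheory.EllipticCurves.mazurTateElement f 2 m).map (algebraMap ℚ (PadicAlgCl 2)) * ∏ v ∈ S₀, ((W.localPolynomialAt v).map (Int.castRingHom (PadicAlgCl 2))).comp (Polynomial.C ((Rat.HeightOneSpectrum.natGenerator v : PadicAlgCl 2)⁻¹) * (Polynomial.X + 1) ^ (PadicInt.toZModPow m (-(Literature.NumberTheory.EllipticCurves.GreenbergVatsal2000.frobeniusExponent 2 (Rat.HeightOneSpectrum.natGenerator v : ℤ_[2])))).val)) %ₘ ((Polynomial.X + 1) ^ 2 ^ m - 1))).supNorm with hu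
  have h0 : 0 < u 0 := by
    simp only [hu]
    exact lt_of_le_of_ne (supNorm_nonneg _)
      (Ne.symm ((supNorm_eq_zero_iff _).not.mpr (wSide_layer_zero_ne_zero S₀ hss ha hr hf hS2)))
  have hmono : ∀ i : ℕ, u 0 ≤ u (0 + 2 * i) := by
    intro i
    induction i with
    | zero => exact le_of_eq (by simp only [hu])
    | succ i ih =>
      refine ih.trans ?_
      simp only [hu]
      exact wSide_supNorm_le_add_two S₀ hss ha hf (0 + 2 * i)
  obtain ⟨i, hi⟩ := hn
  have e : n = 0 + 2 * i := by omega
  have hpos : 0 < u n := by rw [e]; exact h0.trans_le (hmono i)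
  intro hz
  have : u n = 0 := by simp only [hu]; rw [hz, supNorm_zero]
  exact hpos.ne' this

end WSide

/-- **Crux `ThetaLayerLambdaCongruenceAtTwo` BY NAME from (IO′)**: for all data of the crux and every `N₀` there is an even
`n ≥ N₀` with `Θ^{S₀}_n(g;Ω) ≠ 0` and `λ(Θ^{S₀}_n(W)) = λ(Θ^{S₀}_n(g;Ω))` — the `W`-side non-vanishing of (IO) being automatic on
the habitat⁺ (`wSide_even_layer_ne_zero`). [cite: GreenbergVatsal2000, (10) and Thm. (1.4) (shape; the input is a hypothesis)] -/
theorem thetaLayerLambdaCongruenceAtTwo_of_frequently_eq_habitat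
    (h1 : ∀ (W : WeierstrassCurve ℚ) [W.IsElliptic] [W.IsGloballyMinimal], ¬ W.HasCM → W.analyticRank = 0 → Literature.NumberTheory.EllipticCurves.Rank1Residual.GoodSS W 2 → W.frobeniusTrace 2 = 0 → W.Δ < 0 → ∀ (M : ℕ) [NeZero M] (g : CuspForm (CongruenceSubgroup.Gamma0 M) 2) (ι : Literature.NumberTheory.EllipticCurves.ModularForms.coeffField g →+* PadicAlgCl 2) (Ω : ℂ), Odd M → Literature.NumberTheory.EllipticCurves.ModularForms.IsNewform0 g → Literature.NumberTheory.Automorphic.IsCMForm (Literature.NumberTheory.EllipticCurves.ModularForms.liftToGamma1 M 2 g) → Literature.NumberTheory.EllipticCurves.ModularForms.cuspCoeff g 2 = 0 → Literature.NumberTheory.EllipticCurves.IsPlusPeriod g Ω → (∀ ℓ : ℕ, ℓ.Prime → ¬ ℓ ∣ 2 * M * W.conductorNorm ℤ → ‖Literature.NumberTheory.EllipticCurves.embCoeff g ι ℓ - (W.frobeniusTrace ℓ : PadicAlgCl 2)‖ < 1) → ∀ [NeZero (W.conductorNorm ℤ)] (f : CuspForm (CongruenceSubgroup.Gamma0 (W.conductorNorm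 ℤ)) 2), Literature.NumberTheory.EllipticCurves.ModularForms.IsNewformOf W f → ∀ (S₀ : Finset (IsDedekindDomain.HeightOneSpectrum (NumberField.RingOfIntegers ℚ))), (∀ v ∈ S₀, ((2 : ℕ) : NumberField.RingOfIntegers ℚ) ∉ v.asIdeal) → (∀ v : IsDedekindDomain.HeightOneSpectrum (NumberField.RingOfIntegers ℚ), ¬ W.HasGoodReductionAt v → v ∈ S₀) → (∀ v : IsDedekindDomain.HeightOneSpectrum (NumberField.RingOfIntegers ℚ), Rat.HeightOneSpectrum.natGenerator v ∣ M → v ∈ S₀) → ∀ N₀ : ℕ, ∃ n : ℕ, N₀ ≤ n ∧ Even n ∧ (((Literature.NumberTheory.EllipticCurves.mazurTateElementK g Ω 2 n).map ι * ∏ v ∈ S₀, (1 - Polynomial.C (Literature.NumberTheory.EllipticCurves.embCoeff g ι (Rat.HeightOneSpectrum.natGenerator v)) * Polynomial.X + (if Rat.HeightOneSpectrum.natGenerator v ∣ M then 0 else Polynomial.C (Rat.HeightOneSpectrum.natGenerator v : PadicAlgCl 2)) * Polynomial.X ^ 2).comp (Polynomial.C ((Rat.HeightOneSpectrum.natGenerator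 v : PadicAlgCl 2)⁻¹) * (Polynomial.X + 1) ^ (PadicInt.toZModPow n (-(Literature.NumberTheory.EllipticCurves.GreenbergVatsal2000.frobeniusExponent 2 (Rat.HeightOneSpectrum.natGenerator v : ℤ_[2])))).val)) %ₘ ((Polynomial.X + 1) ^ 2 ^ n - 1)) ≠ 0 ∧ Literature.NumberTheory.IwasawaTheory.layerLambda (((Literature.NumberTheory.EllipticCurves.mazurTateElement f 2 n).map (algebraMap ℚ (PadicAlgCl 2)) * ∏ v ∈ S₀, ((W.localPolynomialAt v).map (Int.castRingHom (PadicAlgCl 2))).comp (Polynomial.C ((Rat.HeightOneSpectrum.natGenerator v : PadicAlgCl 2)⁻¹) * (Polynomial.X + 1) ^ (PadicInt.toZModPow n (-(Literature.NumberTheory.EllipticCurves.GreenbergVatsal2000.frobeniusExponent 2 (Rat.HeightOneSpectrum.natGenerator v : ℤ_[2])))).val)) %ₘ ((Polynomial.X + 1) ^ 2 ^ n - 1)) = Literature.NumberTheory.IwasawaTheory.layerLambda (((Literature.NumberTheory.EllipticCurves.mazurTateElementK g Ω 2 n).map ι * ∏ v ∈ S₀, (1 - Polynomial.C (Literature.NumberTheory.EllipticCurves.embCoeff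 g ι (Rat.HeightOneSpectrum.natGenerator v)) * Polynomial.X + (if Rat.HeightOneSpectrum.natGenerator v ∣ M then 0 else Polynomial.C (Rat.HeightOneSpectrum.natGenerator v : PadicAlgCl 2)) * Polynomial.X ^ 2).comp (Polynomial.C ((Rat.HeightOneSpectrum.natGenerator v : PadicAlgCl 2)⁻¹) * (Polynomial.X + 1) ^ (PadicInt.toZModPow n (-(Literature.NumberTheory.EllipticCurves.GreenbergVatsal2000.frobeniusExponent 2 (Rat.HeightOneSpectrum.natGenerator v : ℤ_[2])))).val)) %ₘ ((Polynomial.X + 1) ^ 2 ^ n - 1))) :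
    Summit.BirchSwinnertonDyer.BirchSwinnertonDyer.Theses.ResidualThetaTransportAtTwo.ThetaLayerLambdaCongruenceAtTwo := by
  refine thetaLayerLambdaCongruenceAtTwo_of_frequently_eq ?_
  intro W _ _ hcm hr hss ha hΔ M _ g ι Ω hodd hnew hcmg ha2 hΩ hcong _ f hf S₀ hS2 hSW hSM N₀
  obtain ⟨n, hn, he, hG0, hlam⟩ := h1 W hcm hr hss ha hΔ M g ι Ω hodd hnew hcmg ha2 hΩ hcong f hf S₀ hS2 hSW hSM N₀
  exact ⟨n, hn, he, wSide_even_layer_ne_zero S₀ hss ha hr hf hS2 he, hG0, hlam⟩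

end Summit.BirchSwinnertonDyer.BirchSwinnertonDyer.Theorems.ThetaLayerLambdaCongruenceAtTwo

end
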